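import Mathlib
import Literature.Analysis.FluidPDE.VectorCalculus
import Literature.Analysis.FluidPDE.PolynomialFieldCertificates
import Summits.NavierStokesRegularity.NavierStokesRegularity.Theorems.ThreadingFluxAzimuthalCartanDefs
import HarnessLib

/-!
# Crux `PoloidalLiouville` (stmt-NavierStokesRegularity-1222, wall W1), crux idea «azimuthal-cartan-test» (ns-idea-15 g10,
# `Cruxes/PoloidalLiouville/AzimuthalCartanSketch.lean` v1.3c): J♭ — CALCULUS OF THE POISEUILLE JORDAN MODE on the half-space

Support file (Theorems-side; seat ns-wall-eng-6 g4, cell `ns-wall-extremal`, W1 adjunct; `--supports stmt-NavierStokesRegularity-1222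
--as helper`; 0 kit).  First of two files proving the sketch's J♭ `PoiseuilleJordanMode` BY NAME.  On the half-space `H = {x | 0 < x₀}`
(which contains `ball xTest 1`) the sketch's explicit field `jordanMode` equals `J = J₀e₀ + J₁e₁ + J₂e₂` with
`J₀ = (−φx₁ − ℓx₀)/q`, `J₁ = (φx₀ − ℓx₁)/q`, `J₂ = (q/2)(ℓ − 1)`, `q = x₀² + x₁²`, `ℓ = ½ log q = log ρ`, `φ = arctan(x₁/x₀)`
(`Jordan.jordanMode_eq_Jf`; the horizontal part is `½∇(φ² − ℓ²)`).  This file: first derivatives of `q, ℓ, φ, J₀, J₁, J₂` on `H`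
(`Jordan.hasFDerivAt_Jf`, explicit `Jordan.DJ`), `div J = 0` (`Jordan.divergence_Jf`), `curl J = (ℓ − ½)(x₁, −x₀, 0)` hence
`⟪x, curl J⟫ = 0` (`Jordan.inner_curl_Jf`: UNTHREADED about `0`), and real-analyticity of `J` on `H` (`Jordan.analyticAt_Jf`).  The
Laplacian, the tilt clause and the assembly are in `ThreadingFluxAzimuthalCartanPoiseuilleJordanMode.lean`.

HONEST LABEL: explicit calculus for one closed-form field (information-grade); nothing about `PoloidalLiouville` (1222), its steady
stratum or NS regularity (all OPEN) is claimed.  [cite: MajdaBertozziCUP2002, §1.1 (vector identities)]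
-/

-- the summit and its single problem share the name (D-0017 nested layout)
set_option linter.dupNamespace false

noncomputable section

open Set Function Filter Metric
open scoped RealInnerProductSpace Topology
open Literature.Analysis.FluidPDE Literature.Analysis.Calculus.MvPoly Literature.Analysis.FluidPDE.PolyFieldCert
open Summit.NavierStokesRegularity.NavierStokesRegularity.Theorems.PoloidalLiouville.CentreJet (E3 IsUnthreadedAbout IsSteadyNSOn)

namespace Summit.NavierStokesRegularity.NavierStokesRegularity.Theorems.PoloidalLiouville.AzimuthalCartan

namespace Jordan

/-- The half-space `H = {x | 0 < x₀}` — it contains `ball xTest 1` and misses the axis. -/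
def H : Set E3 := {x | 0 < x 0}

/-- Coordinate differential `dxᵢ`. -/
abbrev dx (i : Fin 3) : E3 →L[ℝ] ℝ := EuclideanSpace.proj i

/-- `dxᵢ v = vᵢ`. -/
@[simp] theorem dx_apply (i : Fin 3) (v : E3) : dx i v = v i := rfl

/-- `q = x₀² + x₁²` (= `cylRadius ^ 2`). -/
def q (x : E3) : ℝ := x 0 ^ 2 + x 1 ^ 2

/-- `ℓ = log ρ = ½ log q`. -/
def ell (x : E3) : ℝ := Real.log (q x) / 2

/-- `φ = arctan (x₁/x₀)` (= `azimuth`). -/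
def phi (x : E3) : ℝ := Real.arctan (x 1 / x 0)

/-- `H` is open. -/
theorem isOpen_H : IsOpen H := isOpen_lt continuous_const (EuclideanSpace.proj (0 : Fin 3)).continuous

/-- `q > 0` on `H`. -/
theorem q_pos {x : E3} (hx : x ∈ H) : 0 < q x := by
  have : 0 < x 0 := hx
  unfold q; positivity

/-- `x₀ ≠ 0` on `H`. -/
theorem x0_ne {x : E3} (hx : x ∈ H) : x 0 ≠ 0 := ne_of_gt hx

/-- Coordinates are their own differentials. -/
theorem hasFDerivAt_coord (i : Fin 3) (x : E3) : HasFDerivAt (fun y : E3 => y i) (dx i) x := (dx i).hasFDerivAt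

/-- `Dq = 2x₀ dx₀ + 2x₁ dx₁`. -/
theorem hasFDerivAt_q (x : E3) : HasFDerivAt q ((2 * x 0) • dx 0 + (2 * x 1) • dx 1) x := by
  have h := ((hasFDerivAt_coord 0 x).pow 2).add ((hasFDerivAt_coord 1 x).pow 2)
  refine (h.congr_fderiv ?_)
  ext v
  simp only [_root_.add_apply, _root_.smul_apply, dx_apply, smul_eq_mul, Nat.add_one_sub_one, pow_one]
  ring

/-- `Dℓ = (x₀ dx₀ + x₁ dx₁)/q` on `H`. -/
theorem hasFDerivAt_ell {x : E3} (hx : x ∈ H) :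
    HasFDerivAt ell ((x 0 / q x) • dx 0 + (x 1 / q x) • dx 1) x := by
  have hq := q_pos hx
  have e : ell = fun y => Real.log (q y) * (1 / 2) := funext fun y => by simp [ell, div_eq_mul_inv]
  rw [e]
  refine (((hasFDerivAt_q x).log hq.ne').mul_const (1 / 2)).congr_fderiv ?_
  ext v
  simp only [_root_.add_apply, _root_.smul_apply, dx_apply, smul_eq_mul]
  field_simp

/-- `Dφ = (−x₁ dx₀ + x₀ dx₁)/q` on `H`. -/
theorem hasFDerivAt_phi {x : E3} (hx : x ∈ H) :
    HasFDerivAt phi ((-(x 1) / q x) • dx 0 + (x 0 / q x) • dx 1) x := by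
  have h0 := x0_ne hx
  have hq := (q_pos hx).ne'
  have hinv : HasFDerivAt (fun y : E3 => (y 0)⁻¹) ((-(x 0 ^ 2)⁻¹) • dx 0) x := by
    have h := (hasDerivAt_inv h0).comp_hasFDerivAt x (hasFDerivAt_coord 0 x)
    refine h.congr_fderiv ?_
    ext v; simp
  have hdiv : HasFDerivAt (fun y : E3 => y 1 / y 0) ((x 0)⁻¹ • dx 1 + (x 1) • ((-(x 0 ^ 2)⁻¹) • dx 0)) x := by
    have h := (hasFDerivAt_coord 1 x).mul hinv
    have e : (fun y : E3 => y 1 / y 0) = fun y => y 1 * (y 0)⁻¹ := funext fun y => div_eq_mul_inv _ _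
    rw [e]
    refine h.congr_fderiv ?_
    ext v; simp; ring
  have h := (Real.hasDerivAt_arctan (x 1 / x 0)).comp_hasFDerivAt x hdiv
  refine h.congr_fderiv ?_
  ext v
  simp only [_root_.smul_apply, _root_.add_apply, dx_apply, smul_eq_mul, q]
  field_simp
  ring

/-- `D(1/q) = −Dq/q²` on `H`. -/
theorem hasFDerivAt_inv_q {x : E3} (hx : x ∈ H) :
    HasFDerivAt (fun y => (q y)⁻¹) ((-(2 * x 0) / q x ^ 2) • dx 0 + (-(2 * x 1) / q x ^ 2) • dx 1) x := by
  have hq := (q_pos hx).ne'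
  refine ((hasDerivAt_inv hq).comp_hasFDerivAt x (hasFDerivAt_q x)).congr_fderiv ?_
  ext v
  simp only [_root_.add_apply, _root_.smul_apply, dx_apply, smul_eq_mul]
  field_simp
  ring

/-! ### The Jordan mode in Cartesian form -/

/-- Standard basis vector `eᵢ`. -/
abbrev e (i : Fin 3) : E3 := EuclideanSpace.single i (1 : ℝ)

/-- Horizontal component `J₀ = (−φ x₁ − ℓ x₀)/q`. -/
def J0 (x : E3) : ℝ := (-(phi x) * x 1 - ell x * x 0) / q x
/-- Horizontal component `J₁ = (φ x₀ − ℓ x₁)/q`. -/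
def J1 (x : E3) : ℝ := (phi x * x 0 - ell x * x 1) / q x
/-- Axial component `J₂ = (q/2)(ℓ − 1)`. -/
def J2 (x : E3) : ℝ := q x / 2 * (ell x - 1)

/-- The Jordan mode as `J₀ e₀ + J₁ e₁ + J₂ e₂`. -/
def Jf (x : E3) : E3 := J0 x • e 0 + J1 x • e 1 + J2 x • e 2

/-- `∂₀J₀ = −∂₁J₁`. -/
def A (x : E3) : ℝ := (x 1 ^ 2 - x 0 ^ 2 + (x 0 ^ 2 - x 1 ^ 2) * ell x + 2 * x 0 * x 1 * phi x) / q x ^ 2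
/-- `∂₁J₀ = ∂₀J₁`. -/
def B (x : E3) : ℝ := (-(2 * x 0 * x 1) + 2 * x 0 * x 1 * ell x + (x 1 ^ 2 - x 0 ^ 2) * phi x) / q x ^ 2
/-- `∂₀J₂ / x₀ = ∂₁J₂ / x₁ = ℓ − ½`. -/
def C (x : E3) : ℝ := ell x - 1 / 2

/-- `DJ₀ = A dx₀ + B dx₁` on `H`. -/
theorem hasFDerivAt_J0 {x : E3} (hx : x ∈ H) : HasFDerivAt J0 (A x • dx 0 + B x • dx 1) x := by
  have hq := (q_pos hx).ne'
  have h := (((hasFDerivAt_phi hx).neg.mul (hasFDerivAt_coord 1 x)).sub ((hasFDerivAt_ell hx).mul (hasFDerivAt_coord 0 x))).mul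
    (hasFDerivAt_inv_q hx)
  have e1 : J0 = fun y => (-(phi y) * y 1 - ell y * y 0) * (q y)⁻¹ := funext fun y => div_eq_mul_inv _ _
  rw [e1]
  refine h.congr_fderiv ?_
  ext v
  simp only [_root_.add_apply, _root_.sub_apply, _root_.smul_apply, dx_apply, smul_eq_mul, A, B,
    _root_.neg_apply, Pi.mul_apply, Pi.sub_apply, Pi.neg_apply]
  simp only [q] at hq ⊢
  field_simp
  ring

/-- `DJ₁ = B dx₀ − A dx₁` on `H`. -/
theorem hasFDerivAt_J1 {x : E3} (hx : x ∈ H) : HasFDerivAt J1 (B x • dx 0 + (-(A x)) • dx 1) x := by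
  have hq := (q_pos hx).ne'
  have h := (((hasFDerivAt_phi hx).mul (hasFDerivAt_coord 0 x)).sub ((hasFDerivAt_ell hx).mul (hasFDerivAt_coord 1 x))).mul
    (hasFDerivAt_inv_q hx)
  have e1 : J1 = fun y => (phi y * y 0 - ell y * y 1) * (q y)⁻¹ := funext fun y => div_eq_mul_inv _ _
  rw [e1]
  refine h.congr_fderiv ?_
  ext v
  simp only [_root_.add_apply, _root_.sub_apply, _root_.smul_apply, dx_apply, smul_eq_mul, A, B, Pi.mul_apply,
    Pi.sub_apply]
  simp only [q] at hq ⊢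
  field_simp
  ring

/-- `DJ₂ = C (x₀ dx₀ + x₁ dx₁)` on `H`. -/
theorem hasFDerivAt_J2 {x : E3} (hx : x ∈ H) : HasFDerivAt J2 ((x 0 * C x) • dx 0 + (x 1 * C x) • dx 1) x := by
  have hq := (q_pos hx).ne'
  have h := ((hasFDerivAt_q x).mul_const (1 / 2 : ℝ)).mul ((hasFDerivAt_ell hx).sub_const 1)
  have e1 : J2 = fun y => (q y * (1 / 2)) * (ell y - 1) := funext fun y => by simp [J2, div_eq_mul_inv]
  rw [e1]
  refine h.congr_fderiv ?_
  ext v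
  simp only [_root_.add_apply, _root_.smul_apply, dx_apply, smul_eq_mul, C]
  simp only [q] at hq ⊢
  field_simp
  ring

/-! ### The derivative of the field, divergence, curl -/

/-- The derivative of the Jordan mode on `H` (explicit). -/
def DJ (x : E3) : E3 →L[ℝ] E3 :=
  (A x • dx 0 + B x • dx 1).smulRight (e 0) + (B x • dx 0 + (-(A x)) • dx 1).smulRight (e 1) +
    ((x 0 * C x) • dx 0 + (x 1 * C x) • dx 1).smulRight (e 2)

/-- `DJ` is the derivative of `J` on `H`. -/
theorem hasFDerivAt_Jf {x : E3} (hx : x ∈ H) : HasFDerivAt Jf (DJ x) x :=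
  (((hasFDerivAt_J0 hx).smul_const (e 0)).add ((hasFDerivAt_J1 hx).smul_const (e 1))).add
    ((hasFDerivAt_J2 hx).smul_const (e 2))

/-- Components of `DJ(x) h`. -/
theorem DJ_apply (x h : E3) :
    DJ x h = WithLp.toLp 2 ![A x * h 0 + B x * h 1, B x * h 0 - A x * h 1, C x * (x 0 * h 0 + x 1 * h 1)] := by
  ext i
  fin_cases i <;> simp [DJ, e] <;> ring

/-- `fderiv J = DJ` on `H`. -/
theorem fderiv_Jf {x : E3} (hx : x ∈ H) : fderiv ℝ Jf x = DJ x := (hasFDerivAt_Jf hx).fderiv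

/-- `div J = 0` on `H`. -/
theorem divergence_Jf {x : E3} (hx : x ∈ H) : VectorCalculus.divergence Jf x = 0 := by
  rw [divergence_eq_sum_inner_fderiv (EuclideanSpace.basisFun (Fin 3) ℝ), fderiv_Jf hx, Fin.sum_univ_three]
  simp [DJ_apply, EuclideanSpace.inner_single_left]

/-- `curl J = C • (x₁, −x₀, 0)` on `H` (`= −(ℓ − ½) ρ e_φ`). -/
theorem curl_Jf {x : E3} (hx : x ∈ H) : curl Jf x = WithLp.toLp 2 ![x 1 * C x, -(x 0 * C x), 0] := by
  ext i
  fin_cases i <;> simp [curl, fderiv_Jf hx, DJ_apply] <;> ring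

/-- The Jordan mode is unthreaded about `0` on `H`: `⟪x, curl J x⟫ = 0`. -/
theorem inner_curl_Jf {x : E3} (hx : x ∈ H) : ⟪x - 0, curl Jf x⟫ = 0 := by
  rw [sub_zero, curl_Jf hx]
  simp [EuclideanSpace.inner_eq_star_dotProduct, dotProduct, Fin.sum_univ_three]; ring

/-! ### Identification with the sketch's `jordanMode` -/

/-- `cylRadius² = q`. -/
theorem cylRadius_sq (x : E3) : cylRadius x ^ 2 = q x := by
  unfold cylRadius q
  exact Real.sq_sqrt (by positivity)

/-- `log cylRadius = ℓ`. -/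
theorem log_cylRadius (x : E3) : Real.log (cylRadius x) = ell x := by
  unfold cylRadius ell q
  exact Real.log_sqrt (by positivity)

/-- The sketch's `jordanMode` is `J` (everywhere). -/
theorem jordanMode_eq_Jf : jordanMode = Jf := by
  funext x
  have h1 := cylRadius_sq x
  have h2 := log_cylRadius x
  ext i
  fin_cases i <;> simp [jordanMode, Jf, J0, J1, J2, azimuth, phi, e, h1, h2]

/-! ### Analyticity on the half-space -/

/-- `q` is analytic. -/
theorem analyticAt_q (x : E3) : AnalyticAt ℝ q x :=
  (((dx 0).analyticAt x).pow 2).add (((dx 1).analyticAt x).pow 2)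

/-- `ℓ` is analytic on `H`. -/
theorem analyticAt_ell {x : E3} (hx : x ∈ H) : AnalyticAt ℝ ell x := by
  have h : AnalyticAt ℝ (fun y => Real.log (q y) / 2) x := ((analyticAt_log (q_pos hx)).comp (analyticAt_q x)).div_const
  exact h

/-- `φ` is analytic on `H`. -/
theorem analyticAt_phi {x : E3} (hx : x ∈ H) : AnalyticAt ℝ phi x := by
  have hq : AnalyticAt ℝ (fun y : E3 => y 1 / y 0) x := ((dx 1).analyticAt x).div ((dx 0).analyticAt x) (x0_ne hx)
  exact ((Real.contDiff_arctan (n := ⊤)).contDiffAt.analyticAt).comp hq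

/-- `J₀` is analytic on `H`. -/
theorem analyticAt_J0 {x : E3} (hx : x ∈ H) : AnalyticAt ℝ J0 x :=
  ((((analyticAt_phi hx).neg.mul ((dx 1).analyticAt x)).sub ((analyticAt_ell hx).mul ((dx 0).analyticAt x))).div
    (analyticAt_q x) (q_pos hx).ne')

/-- `J₁` is analytic on `H`. -/
theorem analyticAt_J1 {x : E3} (hx : x ∈ H) : AnalyticAt ℝ J1 x :=
  ((((analyticAt_phi hx).mul ((dx 0).analyticAt x)).sub ((analyticAt_ell hx).mul ((dx 1).analyticAt x))).div
    (analyticAt_q x) (q_pos hx).ne')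

/-- `J₂` is analytic on `H`. -/
theorem analyticAt_J2 {x : E3} (hx : x ∈ H) : AnalyticAt ℝ J2 x := by
  have h : AnalyticAt ℝ (fun y => q y / 2 * (ell y - 1)) x :=
    (analyticAt_q x).div_const.mul ((analyticAt_ell hx).sub analyticAt_const)
  exact h

/-- `J` is analytic on `H`. -/
theorem analyticAt_Jf {x : E3} (hx : x ∈ H) : AnalyticAt ℝ Jf x :=
  (((analyticAt_J0 hx).smul analyticAt_const).add ((analyticAt_J1 hx).smul analyticAt_const)).add
    ((analyticAt_J2 hx).smul analyticAt_const)

/-- `J` is smooth on `H`. -/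
theorem contDiffAt_Jf {x : E3} (hx : x ∈ H) {n : WithTop ℕ∞} : ContDiffAt ℝ n Jf x :=
  (analyticAt_Jf hx).contDiffAt


end Jordan

end Summit.NavierStokesRegularity.NavierStokesRegularity.Theorems.PoloidalLiouville.AzimuthalCartan

end
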